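import Summits.SmoothPoincare4.SmoothPoincare4.Theorems.WeakReductionDescentDependentTripleGenusThreeStandardSphereFraming
import Summits.SmoothPoincare4.SmoothPoincare4.Theorems.WeakReductionDescentDependentTripleGenusThreeStandardSurgeryInversion
import Literature.Topology.FourManifolds.SurgeryTraceTop
import Literature.Topology.FourManifolds.HomotopyS4CompactProofs

/-!
# Crux `WeakReductionDescent.DependentTripleGenusThreeStandard` (stmt-SmoothPoincare4-18000), line
# `Sketch`: the 4-dimensional step of the apex — every smoothly embedded 2-sphere of a homotopy
# 4-sphere presents it as a circle surgery on the sphere-surgered manifold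

Helper file (`--supports stmt-SmoothPoincare4-18000`).  The apex stub `stub_loopPartnerNoRange`
of the registered skeleton (`Cruxes/DependentTripleGenusThreeStandard/Lines/Sketch.lean`) must
present `M ≃ₕ S⁴` as `IsCircleSurgery X′ M ℓ` for an `X′` carrying a genus-`≤ 2` GK-trisection;
in the cap-sphere plan (card `cap-sphere-surgery`) `X′` is the surgery of `M` along the cap sphere
`Q = P ∪ D₀ ∪ D₁ ∪ D₂`.  This file packages the part of that step which does not depend on `Q`
being the cap sphere: for ANY smoothly embedded `2`-sphere `q` of a homotopy `4`-sphere `M`,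

* `q` has a framed tube `ν` (`helper_exists_framedSphereFamily_of_homotopySphere`, p168316:
  null-homotopic ⇒ trivial normal bundle, Kirby 1989 VIII.2);
* surgery along `ν` exists as a closed smooth `4`-manifold `X′`
  (`SurgeryTrace.exists_isSurgery_isCobordant`: the top end of the trace, Milnor 1965 Thm. 3.12);
* `M` is a circle surgery on `X′` (`helper_isCircleSurgery_of_isSurgery_sphereTwo`: the
  `(2,2)` sphere surgery is undone by surgery on the core circle of the new `D³ × S¹`;
  Aranda–Zupan 2025 Prop. 5.5, "conversely, `X` is obtained by surgery on a loop in `X′`").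

So `helper_exists_loopPartner_of_embeddedSphere`: **every smoothly embedded `S²` in a homotopy
4-sphere `M` yields a closed smooth `X′` and a loop `ℓ ⊂ X′` with `IsCircleSurgery X′ M ℓ`, `X′`
being the surgery of `M` along (a framing of) that sphere.**  What the apex stub still owes is the
CHOICE of the sphere (the smoothed cap sphere of a pants-type triple with a doubly primitive cuff)
and the genus-`≤ 2` GK-trisection of the resulting `X′`.  No definition, no named fact.

References: R. Aranda, A. Zupan, arXiv:2503.04607 (2025), Prop. 5.5 (pp. 19–20), §7 (pp. 25–26);
J. Milnor, *Lectures on the h-cobordism theorem* (1965), Thm. 3.12; R. Kirby, *The topology of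
4-manifolds* (1989), VIII.2; R. Gompf, A. Stipsicz (1999), §5.2.
-/

-- the registered namespace `Summit.SmoothPoincare4.SmoothPoincare4.Theorems…` repeats a component
set_option linter.dupNamespace false

noncomputable section

open scoped Manifold ContDiff Topology ContinuousMap
open Set Function
open Literature.Topology.FourManifolds

namespace Summit.SmoothPoincare4.SmoothPoincare4.Theorems

/-- **REGISTERED helper (line `Sketch`): a smoothly embedded 2-sphere of a homotopy 4-sphere
presents it as a circle surgery on the sphere-surgered manifold.**  For `M ≃ₕ S⁴` and a smooth
embedding `q : S² → M` there are a closed smooth 4-manifold `X′` (compact, Hausdorff, second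
countable), a framed tube `ν` of `q` with `ν.IsSurgery (𝓡 4) X′` (`X′` is `M` surgered along `q`),
and a loop `ℓ ⊂ X′` with `IsCircleSurgery (𝓡 4) (𝓡 4) X′ M ℓ`.  Assembly of
`helper_exists_framedSphereFamily_of_homotopySphere` (framing), `SurgeryTrace.exists_isSurgery_isCobordant`
(existence of the surgered closed manifold; `M` is compact as a homotopy 4-sphere) and
`helper_isCircleSurgery_of_isSurgery_sphereTwo` (inversion).
[cite: ArandaZupan2025, Prop. 5.5 (pp. 19–20)] [cite: MilnorHCobordism1965, Thm. 3.12 (PDF pp. 17–19)] [cite: Kirby1989, VIII.2] -/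
theorem helper_exists_loopPartner_of_embeddedSphere :
    ∀ (M : Type) [TopologicalSpace M] [T2Space M] [SecondCountableTopology M]
      [ChartedSpace (EuclideanSpace ℝ (Fin 4)) M] [IsManifold (𝓡 4) ∞ M],
      M ≃ₕ (Metric.sphere (0 : EuclideanSpace ℝ (Fin 5)) 1) →
      ∀ q : Metric.sphere (0 : EuclideanSpace ℝ (Fin 3)) 1 → M,
        Manifold.IsSmoothEmbedding (𝓡 2) (𝓡 4) ∞ q →
        ∃ (X' : Type) (_ : TopologicalSpace X') (_ : T2Space X') (_ : SecondCountableTopology X')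
          (_ : ChartedSpace (EuclideanSpace ℝ (Fin 4)) X') (_ : IsManifold (𝓡 4) ∞ X')
          (_ : CompactSpace X') (ν : FramedSphereFamily (𝓡 4) M Unit 2 2)
          (ℓ : Metric.sphere (0 : EuclideanSpace ℝ (Fin 2)) 1 → X'),
          ν.sphere () = q ∧ ν.IsSurgery (𝓡 4) X' ∧ IsCircleSurgery (𝓡 4) (𝓡 4) X' M ℓ := by
  intro M _ _ _ _ _ e q hq
  haveI : CompactSpace M := compactSpace_of_homotopyEquiv_sphere_four_holds M e
  obtain ⟨ν, hν⟩ := helper_exists_framedSphereFamily_of_homotopySphere M e q hq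
  obtain ⟨X', hX'top, hX'cs, hX'man, hc, ht2, hsc, hs, -⟩ :=
    SurgeryTrace.exists_isSurgery_isCobordant (n := 3) (k := 2) (l := 1) ν (by norm_num)
  haveI := ht2
  haveI := hsc
  obtain ⟨ℓ, hℓ⟩ := helper_isCircleSurgery_of_isSurgery_sphereTwo M ν X' hs
  exact ⟨X', hX'top, ht2, hsc, hX'cs, hX'man, hc, ν, ℓ, hν, hs, hℓ⟩

end Summit.SmoothPoincare4.SmoothPoincare4.Theorems

end
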